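/-
Copyright (c) 2026 the pub-hodgecm-mathlib formalisation cell (harness21).  Prover seat hodgecm-mathlib-K2E1-p02 (g5), Track B ∕ K2-LIT,
h413 = `stmt-HodgeConjecture-24833`, line `K2_E1_TraceFormulaBeta`, «EIS-RANK-ONE» rung R6d₂ part (b): the DILATION BOUND — along the torus the big-cell function
dilates, its non-zero Fourier coefficients scale by Tate's Lemma 4.1.2, and the Fourier-side decay binder turns `E − E_B` into `O(H^{1−σ−β})` (hypothesis-first).  2026-09-04.
-/
import Summits.HodgeConjecture.HodgeConjecture.Theorems.K2E1EisensteinMinusConstantTermPoissonU2   -- ★ part (a): `E − E_B = μ(D)⁻¹ Σ_{ξ≠0} Φ̂_g(ξ)`, its norm form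
import Literature.NumberTheory.Automorphic.AdelicPoissonScaled                                      -- ★ Tate 4.1.2 `norm_adeleFourierCoeff_comp_mul_sub`
import Mathlib.Analysis.SpecialFunctions.Pow.Real
import HarnessLib

/-!
# h413 ∕ Track B «K2-LIT», «EIS-RANK-ONE» R6d₂ (b) — helper `K2E1EisensteinMinusConstantTermBoundU2`:
# the dilation bound `‖E(f)(g) − E(f)_B(g)‖ ≤ μ(D)⁻¹ · ‖m‖ · |λ|⁻¹ · Σ_{ξ≠0} ‖𝓕Φ_k(ξλ⁻¹)‖ ≤ μ(D)⁻¹ · C · |λ|^{σ+β−1}` on `U(J₂)`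

Cell `pub/hodgecm-mathlib`, crux H413 = `stmt-HodgeConjecture-24833`, route `HCCMUnconditional`; DEAL «EIS-R6d₂» of the dealer K2E1-plan (g3) 2026-09-04T05:01:15Z,
REPORT-FIRST 05:04:02Z «=» 05:04:18Z (three files (a) Poisson packaging ★ p857537, (b) THIS FILE, (c) the binder for `K`-finite flat sections).  THEOREMS ONLY (no `def`,
no `instance`, no `notation`, no named-fact hypothesis, no `sorry`); lane `--kind proof --supports stmt-HodgeConjecture-24833 --as helper` (count-neutral).

THE MECHANISM (Garrett (2018) §2.9; Gelbart (1975) Lemma 9.13 for `GL₂`).  Along the Iwasawa decomposition `g = u · a · k` of `U(J₂)(𝔸_F)` the big-cell function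
of part (a) DILATES: `Φ_g(x) = m · Φ_k(λ(x − y))` with `λ = N_{E/F}(α)⁻¹ ∈ 𝕀_F` (`a = diag(α, ᾱ⁻¹)`: `a⁻¹ n(b) a = n(b∕N α)`), `y = −x_u` (the coordinate of `u`) and
`m = χ(ᾱ⁻¹)‖α‖_E^{−z}` (the section law at `w₀ a w₀⁻¹ = diag(ᾱ⁻¹, α)`) — the STRUCTURE HYPOTHESIS `hdil` of this file (its derivation from the group law is the
sequel `K2E1BigCellLineDilationU2`).  Then by Tate's Lemma 4.1.2 (★ `norm_adeleFourierCoeff_comp_mul_sub`) `‖Φ̂_g(ξ)‖ = ‖m‖ · |λ|⁻¹ · ‖𝓕Φ_k(ξλ⁻¹)‖`, so part (a) gives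
`‖E − E_B‖(g) ≤ μ(D)⁻¹ ‖m‖ |λ|⁻¹ Σ_{ξ≠0} ‖𝓕Φ_k(ξλ⁻¹)‖`, and the FOURIER-SIDE DECAY BINDER `Σ_{ξ≠0} ‖𝓕Φ_k(ξΛ)‖ ≤ C |Λ|^{−β}` for `|Λ| ≥ 1` (discharged in (c) for
`K`-finite flat sections) yields `‖E − E_B‖(g) ≤ μ(D)⁻¹ · C · ‖m‖ · |λ|^{β−1}`; with `‖m‖ = |λ|^{σ}` (`σ = Re z`, `‖α‖_E = |λ|⁻¹`) this is `μ(D)⁻¹ C |λ|^{σ+β−1} ≤ μ(D)⁻¹ C`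
as soon as `|λ| ≤ 1`, i.e. `H(g) ≥ H(k)`: BOUNDEDNESS in the cusp (R6e) and DECAY `H^{−(σ+β−1)}` (R7) in one stroke.

* §1 (any number field `K`; pure adelic Fourier analysis) `adeleFourierCoeff_const_mul`, **`norm_adeleFourierCoeff_dilate`** (`‖Φ̂(ξ)‖ = ‖m‖|λ|⁻¹‖𝓕φ(ξλ⁻¹)‖` for
  `Φ = m · φ(λ(· − y))`), `summable_norm_adeleFourierCoeff_dilate`, **`tsum_indicator_norm_adeleFourierCoeff_dilate`** (the `ξ ≠ 0` sums scale by `‖m‖|λ|⁻¹`).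
* §2 (`U(J₂)`) **`norm_sub_borelConstantTerm_le_of_dilation_two`** — part (a)'s bound + §1: `‖E − E_B‖(g) ≤ μ(D)⁻¹ · ‖m‖ · |λ|⁻¹ · Σ_ξ 𝟙_{ξ≠0} ‖𝓕Φ_k(ξλ⁻¹)‖`;
  **`norm_sub_borelConstantTerm_le_of_decay_two`** — with the binder value `Σ_ξ 𝟙_{ξ≠0}‖𝓕Φ_k(ξλ⁻¹)‖ ≤ C·|λ⁻¹|^{−β}`: `≤ μ(D)⁻¹ · C · ‖m‖ · |λ|^{β−1}`;
  **`norm_sub_borelConstantTerm_le_rpow_two`** — with `‖m‖ = |λ|^{σ}`: `≤ μ(D)⁻¹ · C · |λ|^{σ+β−1}`; **`norm_sub_borelConstantTerm_le_const_two`** — if moreover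
  `|λ| ≤ 1` and `1 ≤ σ + β`: `≤ μ(D)⁻¹ · C` (the uniform bound `M` of R6e, all hypotheses on display).

HONEST LABEL.  Count-neutral helper; proves no printed statement; HC_CM is proved only modulo the 7 printed citations (2 remaining named inputs: hLiu418 =
`stmt-HodgeConjecture-24832`, h413 = `stmt-HodgeConjecture-24833`) until rung 0 closes.

## References
* [Garrett2018] P. Garrett, *Modern Analysis of Automorphic Forms by Example*, vol. 1 (2018), §2.9 (rapid decay of `E − E_P` via Poisson and dilation).
* [Gelbart1975] S. Gelbart, *Automorphic forms on adele groups* (1975), Lemma 9.13, (9.45) (the dilation by the simple root in the cusp).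
* [CasselsFrohlichANT1967] J. W. S. Cassels, A. Fröhlich (eds.), *Algebraic Number Theory* (1967), Ch. XV (Tate) Lemma 4.1.2, Lemma 4.2.4.
-/

set_option autoImplicit false
set_option linter.dupNamespace false  -- the mandated namespace repeats the summit's segment (`HodgeConjecture.HodgeConjecture`)

noncomputable section

open scoped Matrix NNReal
open MeasureTheory NumberField IsDedekindDomain MulAction
open Literature.NumberTheory.Automorphic Literature.NumberTheory.Automorphic.UnitaryGroup
open Summit.HodgeConjecture.HodgeConjecture.Cruxes.H413.K2E1BorelEisensteinU
open Summit.HodgeConjecture.HodgeConjecture.Cruxes.H413.K2E1EisensteinMinusConstantTermPoissonU2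

namespace Summit.HodgeConjecture.HodgeConjecture.Cruxes.H413.K2E1EisensteinMinusConstantTermBoundU2

/-! ## §1 Fourier coefficients of a dilated-translated-scaled function (any number field) -/

section Fourier

variable (K : Type) [Field K] [NumberField K] [MeasurableSpace (AdeleRing (𝓞 K) K)]

/-- `(m · φ)^(ξ) = m · φ̂(ξ)`. [cite: CasselsFrohlichANT1967, Ch. XV Lemma 4.1.2] -/
theorem adeleFourierCoeff_const_mul (μ : Measure (AdeleRing (𝓞 K) K)) (m : ℂ) (φ : AdeleRing (𝓞 K) K → ℂ) (ξ : K) :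
    adeleFourierCoeff μ (fun u => m * φ u) ξ = m * adeleFourierCoeff μ φ ξ := by
  simp only [adeleFourierCoeff_apply, mul_assoc, integral_const_mul]

variable [BorelSpace (AdeleRing (𝓞 K) K)] (μ : Measure (AdeleRing (𝓞 K) K)) [μ.IsAddHaarMeasure]

/-- **`‖Φ̂(ξ)‖ = ‖m‖ · |λ|⁻¹ · ‖𝓕φ(ξλ⁻¹)‖` for `Φ(u) = m · φ(λ(u − y))`** (`𝓕φ(η) = ∫ φ(v) ψ(ηv) dμ` at the adele `η = ξλ⁻¹`; ★ Tate's Lemma 4.1.2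
`norm_adeleFourierCoeff_comp_mul_sub` and linearity). [cite: CasselsFrohlichANT1967, Ch. XV Lemma 4.1.2] -/
theorem norm_adeleFourierCoeff_dilate {Φ φ : AdeleRing (𝓞 K) K → ℂ} (m : ℂ) (lam : (AdeleRing (𝓞 K) K)ˣ) (y : AdeleRing (𝓞 K) K)
    (hdil : ∀ u, Φ u = m * φ ((lam : AdeleRing (𝓞 K) K) * (u - y))) (ξ : K) :
    ‖adeleFourierCoeff μ Φ ξ‖ = ‖m‖ * (((IdeleClassGroup.ideleNorm K lam : ℝ≥0) : ℝ)⁻¹ *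
      ‖∫ v, φ v * (adeleAddChar K (algebraMap K (AdeleRing (𝓞 K) K) ξ * ((lam⁻¹ : (AdeleRing (𝓞 K) K)ˣ) : AdeleRing (𝓞 K) K) * v) : ℂ) ∂μ‖) := by
  have hΦ : Φ = fun u => m * (fun u => φ ((lam : AdeleRing (𝓞 K) K) * (u - y))) u := funext hdil
  rw [hΦ, adeleFourierCoeff_const_mul, norm_mul, norm_adeleFourierCoeff_comp_mul_sub]

/-- Summability transfers along the dilation: `Σ_ξ 𝟙_{ξ≠0}‖𝓕φ(ξλ⁻¹)‖ < ∞ ⟹ Σ_ξ 𝟙_{ξ≠0}‖Φ̂(ξ)‖ < ∞` (indeed for the full sums). [cite: CasselsFrohlichANT1967, Ch. XV Lemma 4.1.2] -/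
theorem summable_norm_adeleFourierCoeff_dilate {Φ φ : AdeleRing (𝓞 K) K → ℂ} (m : ℂ) (lam : (AdeleRing (𝓞 K) K)ˣ) (y : AdeleRing (𝓞 K) K)
    (hdil : ∀ u, Φ u = m * φ ((lam : AdeleRing (𝓞 K) K) * (u - y)))
    (hsum : Summable fun ξ : K =>
      ‖∫ v, φ v * (adeleAddChar K (algebraMap K (AdeleRing (𝓞 K) K) ξ * ((lam⁻¹ : (AdeleRing (𝓞 K) K)ˣ) : AdeleRing (𝓞 K) K) * v) : ℂ) ∂μ‖) :
    Summable fun ξ : K => ‖adeleFourierCoeff μ Φ ξ‖ := by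
  simp_rw [norm_adeleFourierCoeff_dilate K μ m lam y hdil]
  exact (hsum.mul_left _).mul_left _

/-- **The `ξ ≠ 0` sums scale**: `Σ_ξ 𝟙_{ξ≠0} ‖Φ̂(ξ)‖ = ‖m‖ · |λ|⁻¹ · Σ_ξ 𝟙_{ξ≠0} ‖𝓕φ(ξλ⁻¹)‖` for `Φ = m · φ(λ(· − y))`. [cite: CasselsFrohlichANT1967, Ch. XV Lemma 4.1.2] -/
theorem tsum_indicator_norm_adeleFourierCoeff_dilate {Φ φ : AdeleRing (𝓞 K) K → ℂ} (m : ℂ) (lam : (AdeleRing (𝓞 K) K)ˣ) (y : AdeleRing (𝓞 K) K)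
    (hdil : ∀ u, Φ u = m * φ ((lam : AdeleRing (𝓞 K) K) * (u - y))) :
    ∑' ξ : K, ({0}ᶜ : Set K).indicator (fun ξ => ‖adeleFourierCoeff μ Φ ξ‖) ξ =
      ‖m‖ * ((IdeleClassGroup.ideleNorm K lam : ℝ≥0) : ℝ)⁻¹ * ∑' ξ : K, ({0}ᶜ : Set K).indicator (fun ξ =>
        ‖∫ v, φ v * (adeleAddChar K (algebraMap K (AdeleRing (𝓞 K) K) ξ * ((lam⁻¹ : (AdeleRing (𝓞 K) K)ˣ) : AdeleRing (𝓞 K) K) * v) : ℂ) ∂μ‖) ξ := by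
  rw [← tsum_mul_left]
  refine tsum_congr fun ξ => ?_
  by_cases hξ : ξ ∈ ({0}ᶜ : Set K)
  · rw [Set.indicator_of_mem hξ, Set.indicator_of_mem hξ, norm_adeleFourierCoeff_dilate K μ m lam y hdil, mul_assoc]
  · rw [Set.indicator_of_notMem hξ, Set.indicator_of_notMem hξ, mul_zero]

end Fourier

/-! ## §2 `U(J₂)`: the dilation bound and its power-law forms -/

section RankOne

variable {F E : Type} [Field F] [NumberField F] [Field E] [NumberField E] [Algebra F E] [Algebra.IsQuadraticExtension F E] {c : E ≃ₐ[F] E}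
  (hij : (((0 : Fin 2) : ℕ)) + 1 = ((1 : Fin 2) : ℕ)) (hN : 2 = 2 * ((0 : Fin 2) : ℕ) + 2) {δ : E}

/-- **THE DILATION BOUND ON `U(J₂)`**: under the hypotheses of part (a) (★ `norm_eisensteinSeriesU_sub_borelConstantTerm_le_two`, with the summability of `Φ̂_g`
now DERIVED from the dilation) and the STRUCTURE `hdil : Φ_g = m · Φ_k(λ(· − y))` (sequel: `λ = N(α)⁻¹`, `y = −x_u`, `m = χ(ᾱ⁻¹)‖α‖_E^{−z}` along `g = u a k`):
`‖E(f)(g) − E(f)_B(g)‖ ≤ μ(D)⁻¹ · ‖m‖ · |λ|⁻¹ · Σ_ξ 𝟙_{ξ≠0} ‖𝓕Φ_k(ξλ⁻¹)‖`. [cite: Garrett2018, §2.9] [cite: Gelbart1975, Lemma 9.13] -/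
theorem norm_sub_borelConstantTerm_le_of_dilation_two (hcδ : c δ = -δ) (hδ : δ ≠ 0)
    [MeasurableSpace (quasiSplit F E c 2).Adelic] [BorelSpace (quasiSplit F E c 2).Adelic]
    (νN : Measure ↥(adelicUnipotent F E c 2)) [νN.IsMulLeftInvariant] [νN.IsInvInvariant]
    {f : (quasiSplit F E c 2).Adelic → ℂ} (hfm : Measurable f)
    (hfN : ∀ (n : ↥(adelicUnipotent F E c 2)) (y : (quasiSplit F E c 2).Adelic), f ((n : (quasiSplit F E c 2).Adelic) * y) = f y)
    (hfB : ∀ b ∈ borelU (c : E →+* E) ((StdForm.antidiagonal 2).over E), ∀ x : (quasiSplit F E c 2).Adelic, f ((quasiSplit F E c 2).toAdelic b * x) = f x)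
    {𝓕 : Set ↥(adelicUnipotent F E c 2)} (h𝓕 : IsFundamentalDomain ↥(rationalUnipotent F E c 2) 𝓕 νN) (h𝓕₀ : νN 𝓕 ≠ 0) (h𝓕top : νN 𝓕 ≠ ⊤)
    (g : (quasiSplit F E c 2).Adelic)
    (hfin : ∫⁻ u in 𝓕, (∑' q : (quasiSplit F E c 2).quotientSubgroup ⧸ (borelAdelic F E c 2).subgroupOf (quasiSplit F E c 2).quotientSubgroup,
        ‖f ((((q.out : (quasiSplit F E c 2).quotientSubgroup) : (quasiSplit F E c 2).Adelic))⁻¹ * (u : (quasiSplit F E c 2).Adelic) * g)‖ₑ) ∂νN < ⊤)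
    (hs : Summable fun q : Quotient (orbitRel ↥(borelU (c : E →+* E) ((StdForm.antidiagonal 2).over E)) ↥(unitaryGroupOfForm (c : E →+* E) ((StdForm.antidiagonal 2).over E))) =>
      f ((quasiSplit F E c 2).toAdelic (Quotient.out q : ↥(unitaryGroupOfForm (c : E →+* E) ((StdForm.antidiagonal 2).over E))) * g))
    [MeasurableSpace (AdeleRing (𝓞 F) F)] [BorelSpace (AdeleRing (𝓞 F) F)] (μ : Measure (AdeleRing (𝓞 F) F)) [μ.IsAddHaarMeasure]
    {Φ : (AdeleRing (𝓞 F) F) → ℂ} (hΦ : ∀ t, Φ t = f (((quasiSplit F E c 2).toAdelic (weylLongU (c : E →+* E) (rfl : ((StdForm.antidiagonal 2).over E) = ((StdForm.antidiagonal 2).over E)))) * ((middleRootUnipotent hij hN (Multiplicative.ofAdd (traceZeroLine F E c hcδ hδ t)) : ↥(adelicUnipotent F E c 2)) : (quasiSplit F E c 2).Adelic) * g))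
    (hΦc : Continuous Φ) (hΦi : Integrable Φ μ)
    (hloc : ∀ C : Set (AdeleRing (𝓞 F) F), IsCompact C → ∃ u : F → ℝ, Summable u ∧
      ∀ x ∈ C, ∀ ξ : F, ‖Φ (x + algebraMap F (AdeleRing (𝓞 F) F) ξ)‖ ≤ u ξ)
    (hnorm : ((νN 𝓕).toReal⁻¹ : ℝ) • ∫ v : ↥(adelicUnipotent F E c 2), f (((quasiSplit F E c 2).toAdelic (weylLongU (c : E →+* E) (rfl : ((StdForm.antidiagonal 2).over E) = ((StdForm.antidiagonal 2).over E)))) * (v : (quasiSplit F E c 2).Adelic) * g) ∂νN =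
      ((μ (adeleFundamentalDomain F)).toReal⁻¹ : ℂ) * ∫ t, Φ t ∂μ)
    {Φk : (AdeleRing (𝓞 F) F) → ℂ} (m : ℂ) (lam : (AdeleRing (𝓞 F) F)ˣ) (y : (AdeleRing (𝓞 F) F)) (hdil : ∀ t, Φ t = m * Φk ((lam : (AdeleRing (𝓞 F) F)) * (t - y)))
    (hsumk : Summable fun ξ : F =>
      ‖∫ v, Φk v * (adeleAddChar F (algebraMap F (AdeleRing (𝓞 F) F) ξ * ((lam⁻¹ : (AdeleRing (𝓞 F) F)ˣ) : (AdeleRing (𝓞 F) F)) * v) : ℂ) ∂μ‖) :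
    ‖eisensteinSeriesU f g - borelConstantTerm νN 𝓕 (eisensteinSeriesU f) g‖ ≤
      (μ (adeleFundamentalDomain F)).toReal⁻¹ * (‖m‖ * (((IdeleClassGroup.ideleNorm F lam : ℝ≥0) : ℝ))⁻¹ *
        ∑' ξ : F, ({0}ᶜ : Set F).indicator (fun ξ => ‖∫ v, Φk v * (adeleAddChar F (algebraMap F (AdeleRing (𝓞 F) F) ξ * ((lam⁻¹ : (AdeleRing (𝓞 F) F)ˣ) : (AdeleRing (𝓞 F) F)) * v) : ℂ) ∂μ‖) ξ) := by
  have hsum : Summable fun ξ : F => ‖adeleFourierCoeff μ Φ ξ‖ := summable_norm_adeleFourierCoeff_dilate F μ m lam y hdil hsumk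
  have h := norm_eisensteinSeriesU_sub_borelConstantTerm_le_two hij hN hcδ hδ νN hfm hfN hfB h𝓕 h𝓕₀ h𝓕top g hfin hs μ hΦ hΦc hΦi hloc hsum hnorm
  rwa [tsum_indicator_norm_adeleFourierCoeff_dilate F μ m lam y hdil] at h

/-- **… WITH THE FOURIER-SIDE DECAY BINDER**: if `Σ_ξ 𝟙_{ξ≠0} ‖𝓕Φ_k(ξλ⁻¹)‖ ≤ C · |λ⁻¹|^{−β}` (the binder of file (c) at the idele `Λ = λ⁻¹`, `|Λ| ≥ 1` in the cusp),
then `‖E(f)(g) − E(f)_B(g)‖ ≤ μ(D)⁻¹ · C · ‖m‖ · |λ|^{β − 1}`. [cite: Garrett2018, §2.9] -/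
theorem norm_sub_borelConstantTerm_le_of_decay_two (hcδ : c δ = -δ) (hδ : δ ≠ 0)
    [MeasurableSpace (quasiSplit F E c 2).Adelic] [BorelSpace (quasiSplit F E c 2).Adelic]
    (νN : Measure ↥(adelicUnipotent F E c 2)) [νN.IsMulLeftInvariant] [νN.IsInvInvariant]
    {f : (quasiSplit F E c 2).Adelic → ℂ} (hfm : Measurable f)
    (hfN : ∀ (n : ↥(adelicUnipotent F E c 2)) (y : (quasiSplit F E c 2).Adelic), f ((n : (quasiSplit F E c 2).Adelic) * y) = f y)
    (hfB : ∀ b ∈ borelU (c : E →+* E) ((StdForm.antidiagonal 2).over E), ∀ x : (quasiSplit F E c 2).Adelic, f ((quasiSplit F E c 2).toAdelic b * x) = f x)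
    {𝓕 : Set ↥(adelicUnipotent F E c 2)} (h𝓕 : IsFundamentalDomain ↥(rationalUnipotent F E c 2) 𝓕 νN) (h𝓕₀ : νN 𝓕 ≠ 0) (h𝓕top : νN 𝓕 ≠ ⊤)
    (g : (quasiSplit F E c 2).Adelic)
    (hfin : ∫⁻ u in 𝓕, (∑' q : (quasiSplit F E c 2).quotientSubgroup ⧸ (borelAdelic F E c 2).subgroupOf (quasiSplit F E c 2).quotientSubgroup,
        ‖f ((((q.out : (quasiSplit F E c 2).quotientSubgroup) : (quasiSplit F E c 2).Adelic))⁻¹ * (u : (quasiSplit F E c 2).Adelic) * g)‖ₑ) ∂νN < ⊤)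
    (hs : Summable fun q : Quotient (orbitRel ↥(borelU (c : E →+* E) ((StdForm.antidiagonal 2).over E)) ↥(unitaryGroupOfForm (c : E →+* E) ((StdForm.antidiagonal 2).over E))) =>
      f ((quasiSplit F E c 2).toAdelic (Quotient.out q : ↥(unitaryGroupOfForm (c : E →+* E) ((StdForm.antidiagonal 2).over E))) * g))
    [MeasurableSpace (AdeleRing (𝓞 F) F)] [BorelSpace (AdeleRing (𝓞 F) F)] (μ : Measure (AdeleRing (𝓞 F) F)) [μ.IsAddHaarMeasure]
    {Φ : (AdeleRing (𝓞 F) F) → ℂ} (hΦ : ∀ t, Φ t = f (((quasiSplit F E c 2).toAdelic (weylLongU (c : E →+* E) (rfl : ((StdForm.antidiagonal 2).over E) = ((StdForm.antidiagonal 2).over E)))) * ((middleRootUnipotent hij hN (Multiplicative.ofAdd (traceZeroLine F E c hcδ hδ t)) : ↥(adelicUnipotent F E c 2)) : (quasiSplit F E c 2).Adelic) * g))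
    (hΦc : Continuous Φ) (hΦi : Integrable Φ μ)
    (hloc : ∀ C : Set (AdeleRing (𝓞 F) F), IsCompact C → ∃ u : F → ℝ, Summable u ∧
      ∀ x ∈ C, ∀ ξ : F, ‖Φ (x + algebraMap F (AdeleRing (𝓞 F) F) ξ)‖ ≤ u ξ)
    (hnorm : ((νN 𝓕).toReal⁻¹ : ℝ) • ∫ v : ↥(adelicUnipotent F E c 2), f (((quasiSplit F E c 2).toAdelic (weylLongU (c : E →+* E) (rfl : ((StdForm.antidiagonal 2).over E) = ((StdForm.antidiagonal 2).over E)))) * (v : (quasiSplit F E c 2).Adelic) * g) ∂νN =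
      ((μ (adeleFundamentalDomain F)).toReal⁻¹ : ℂ) * ∫ t, Φ t ∂μ)
    {Φk : (AdeleRing (𝓞 F) F) → ℂ} (m : ℂ) (lam : (AdeleRing (𝓞 F) F)ˣ) (y : (AdeleRing (𝓞 F) F)) (hdil : ∀ t, Φ t = m * Φk ((lam : (AdeleRing (𝓞 F) F)) * (t - y)))
    (hsumk : Summable fun ξ : F =>
      ‖∫ v, Φk v * (adeleAddChar F (algebraMap F (AdeleRing (𝓞 F) F) ξ * ((lam⁻¹ : (AdeleRing (𝓞 F) F)ˣ) : (AdeleRing (𝓞 F) F)) * v) : ℂ) ∂μ‖)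
    {C β : ℝ}
    (hdec : ∑' ξ : F, ({0}ᶜ : Set F).indicator (fun ξ => ‖∫ v, Φk v * (adeleAddChar F (algebraMap F (AdeleRing (𝓞 F) F) ξ * ((lam⁻¹ : (AdeleRing (𝓞 F) F)ˣ) : (AdeleRing (𝓞 F) F)) * v) : ℂ) ∂μ‖) ξ ≤ C * ((((IdeleClassGroup.ideleNorm F lam : ℝ≥0) : ℝ))⁻¹) ^ (-β)) :
    ‖eisensteinSeriesU f g - borelConstantTerm νN 𝓕 (eisensteinSeriesU f) g‖ ≤
      (μ (adeleFundamentalDomain F)).toReal⁻¹ * C * ‖m‖ * (((IdeleClassGroup.ideleNorm F lam : ℝ≥0) : ℝ)) ^ (β - 1) := by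
  have hpos : 0 < (((IdeleClassGroup.ideleNorm F lam : ℝ≥0) : ℝ)) := by
    have h0 : IdeleClassGroup.ideleNorm F lam ≠ 0 := ideleNorm_ne_zero (K := F) lam
    exact_mod_cast pos_iff_ne_zero.2 h0
  refine (norm_sub_borelConstantTerm_le_of_dilation_two hij hN hcδ hδ νN hfm hfN hfB h𝓕 h𝓕₀ h𝓕top g hfin hs μ hΦ hΦc hΦi hloc hnorm m lam y hdil hsumk).trans ?_
  have h1 : ‖m‖ * (((IdeleClassGroup.ideleNorm F lam : ℝ≥0) : ℝ))⁻¹ * ∑' ξ : F, ({0}ᶜ : Set F).indicator (fun ξ => ‖∫ v, Φk v * (adeleAddChar F (algebraMap F (AdeleRing (𝓞 F) F) ξ * ((lam⁻¹ : (AdeleRing (𝓞 F) F)ˣ) : (AdeleRing (𝓞 F) F)) * v) : ℂ) ∂μ‖) ξ ≤ ‖m‖ * (((IdeleClassGroup.ideleNorm F lam : ℝ≥0) : ℝ))⁻¹ * (C * ((((IdeleClassGroup.ideleNorm F lam : ℝ≥0) : ℝ))⁻¹) ^ (-β)) :=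
    mul_le_mul_of_nonneg_left hdec (mul_nonneg (norm_nonneg _) (inv_nonneg.2 hpos.le))
  refine (mul_le_mul_of_nonneg_left h1 (inv_nonneg.2 ENNReal.toReal_nonneg)).trans (le_of_eq ?_)
  rw [Real.inv_rpow hpos.le, Real.rpow_neg hpos.le, inv_inv, Real.rpow_sub hpos, Real.rpow_one, div_eq_mul_inv]
  ring

/-- **… IN HEIGHT-EXPONENT FORM**: if moreover `‖m‖ = |λ|^{σ}` (the section law: `‖m‖ = ‖α‖_E^{−σ}`, `|λ| = ‖α‖_E⁻¹`), then
`‖E(f)(g) − E(f)_B(g)‖ ≤ μ(D)⁻¹ · C · |λ|^{σ + β − 1}` — POLYNOMIAL DECAY in `‖α‖_E ∝ H(g)` of order `σ + β − 1` (R7). [cite: Garrett2018, §2.9] -/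
theorem norm_sub_borelConstantTerm_le_rpow_two (hcδ : c δ = -δ) (hδ : δ ≠ 0)
    [MeasurableSpace (quasiSplit F E c 2).Adelic] [BorelSpace (quasiSplit F E c 2).Adelic]
    (νN : Measure ↥(adelicUnipotent F E c 2)) [νN.IsMulLeftInvariant] [νN.IsInvInvariant]
    {f : (quasiSplit F E c 2).Adelic → ℂ} (hfm : Measurable f)
    (hfN : ∀ (n : ↥(adelicUnipotent F E c 2)) (y : (quasiSplit F E c 2).Adelic), f ((n : (quasiSplit F E c 2).Adelic) * y) = f y)
    (hfB : ∀ b ∈ borelU (c : E →+* E) ((StdForm.antidiagonal 2).over E), ∀ x : (quasiSplit F E c 2).Adelic, f ((quasiSplit F E c 2).toAdelic b * x) = f x)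
    {𝓕 : Set ↥(adelicUnipotent F E c 2)} (h𝓕 : IsFundamentalDomain ↥(rationalUnipotent F E c 2) 𝓕 νN) (h𝓕₀ : νN 𝓕 ≠ 0) (h𝓕top : νN 𝓕 ≠ ⊤)
    (g : (quasiSplit F E c 2).Adelic)
    (hfin : ∫⁻ u in 𝓕, (∑' q : (quasiSplit F E c 2).quotientSubgroup ⧸ (borelAdelic F E c 2).subgroupOf (quasiSplit F E c 2).quotientSubgroup,
        ‖f ((((q.out : (quasiSplit F E c 2).quotientSubgroup) : (quasiSplit F E c 2).Adelic))⁻¹ * (u : (quasiSplit F E c 2).Adelic) * g)‖ₑ) ∂νN < ⊤)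
    (hs : Summable fun q : Quotient (orbitRel ↥(borelU (c : E →+* E) ((StdForm.antidiagonal 2).over E)) ↥(unitaryGroupOfForm (c : E →+* E) ((StdForm.antidiagonal 2).over E))) =>
      f ((quasiSplit F E c 2).toAdelic (Quotient.out q : ↥(unitaryGroupOfForm (c : E →+* E) ((StdForm.antidiagonal 2).over E))) * g))
    [MeasurableSpace (AdeleRing (𝓞 F) F)] [BorelSpace (AdeleRing (𝓞 F) F)] (μ : Measure (AdeleRing (𝓞 F) F)) [μ.IsAddHaarMeasure]
    {Φ : (AdeleRing (𝓞 F) F) → ℂ} (hΦ : ∀ t, Φ t = f (((quasiSplit F E c 2).toAdelic (weylLongU (c : E →+* E) (rfl : ((StdForm.antidiagonal 2).over E) = ((StdForm.antidiagonal 2).over E)))) * ((middleRootUnipotent hij hN (Multiplicative.ofAdd (traceZeroLine F E c hcδ hδ t)) : ↥(adelicUnipotent F E c 2)) : (quasiSplit F E c 2).Adelic) * g))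
    (hΦc : Continuous Φ) (hΦi : Integrable Φ μ)
    (hloc : ∀ C : Set (AdeleRing (𝓞 F) F), IsCompact C → ∃ u : F → ℝ, Summable u ∧
      ∀ x ∈ C, ∀ ξ : F, ‖Φ (x + algebraMap F (AdeleRing (𝓞 F) F) ξ)‖ ≤ u ξ)
    (hnorm : ((νN 𝓕).toReal⁻¹ : ℝ) • ∫ v : ↥(adelicUnipotent F E c 2), f (((quasiSplit F E c 2).toAdelic (weylLongU (c : E →+* E) (rfl : ((StdForm.antidiagonal 2).over E) = ((StdForm.antidiagonal 2).over E)))) * (v : (quasiSplit F E c 2).Adelic) * g) ∂νN =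
      ((μ (adeleFundamentalDomain F)).toReal⁻¹ : ℂ) * ∫ t, Φ t ∂μ)
    {Φk : (AdeleRing (𝓞 F) F) → ℂ} (m : ℂ) (lam : (AdeleRing (𝓞 F) F)ˣ) (y : (AdeleRing (𝓞 F) F)) (hdil : ∀ t, Φ t = m * Φk ((lam : (AdeleRing (𝓞 F) F)) * (t - y)))
    (hsumk : Summable fun ξ : F =>
      ‖∫ v, Φk v * (adeleAddChar F (algebraMap F (AdeleRing (𝓞 F) F) ξ * ((lam⁻¹ : (AdeleRing (𝓞 F) F)ˣ) : (AdeleRing (𝓞 F) F)) * v) : ℂ) ∂μ‖)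
    {C β σ : ℝ}
    (hdec : ∑' ξ : F, ({0}ᶜ : Set F).indicator (fun ξ => ‖∫ v, Φk v * (adeleAddChar F (algebraMap F (AdeleRing (𝓞 F) F) ξ * ((lam⁻¹ : (AdeleRing (𝓞 F) F)ˣ) : (AdeleRing (𝓞 F) F)) * v) : ℂ) ∂μ‖) ξ ≤ C * ((((IdeleClassGroup.ideleNorm F lam : ℝ≥0) : ℝ))⁻¹) ^ (-β))
    (hm : ‖m‖ = (((IdeleClassGroup.ideleNorm F lam : ℝ≥0) : ℝ)) ^ σ) :
    ‖eisensteinSeriesU f g - borelConstantTerm νN 𝓕 (eisensteinSeriesU f) g‖ ≤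
      (μ (adeleFundamentalDomain F)).toReal⁻¹ * C * (((IdeleClassGroup.ideleNorm F lam : ℝ≥0) : ℝ)) ^ (σ + β - 1) := by
  have hpos : 0 < (((IdeleClassGroup.ideleNorm F lam : ℝ≥0) : ℝ)) := by
    have h0 : IdeleClassGroup.ideleNorm F lam ≠ 0 := ideleNorm_ne_zero (K := F) lam
    exact_mod_cast pos_iff_ne_zero.2 h0
  refine (norm_sub_borelConstantTerm_le_of_decay_two hij hN hcδ hδ νN hfm hfN hfB h𝓕 h𝓕₀ h𝓕top g hfin hs μ hΦ hΦc hΦi hloc hnorm m lam y hdil hsumk hdec).trans (le_of_eq ?_)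
  rw [hm, mul_assoc, ← Real.rpow_add hpos]
  ring_nf

/-- **… THE UNIFORM BOUND IN THE CUSP (R6e's `∃ M`)**: if moreover `|λ| ≤ 1` (i.e. `H(g) ≥ H(k)`) and `1 ≤ σ + β`, then `‖E(f)(g) − E(f)_B(g)‖ ≤ μ(D)⁻¹ · C` —
independent of `g`; every hypothesis named (`hdil` from the sequel, `hdec`∕`hm` from file (c) ∕ the section law, Poisson's from Godement). [cite: Garrett2018, §2.9] -/
theorem norm_sub_borelConstantTerm_le_const_two (hcδ : c δ = -δ) (hδ : δ ≠ 0)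
    [MeasurableSpace (quasiSplit F E c 2).Adelic] [BorelSpace (quasiSplit F E c 2).Adelic]
    (νN : Measure ↥(adelicUnipotent F E c 2)) [νN.IsMulLeftInvariant] [νN.IsInvInvariant]
    {f : (quasiSplit F E c 2).Adelic → ℂ} (hfm : Measurable f)
    (hfN : ∀ (n : ↥(adelicUnipotent F E c 2)) (y : (quasiSplit F E c 2).Adelic), f ((n : (quasiSplit F E c 2).Adelic) * y) = f y)
    (hfB : ∀ b ∈ borelU (c : E →+* E) ((StdForm.antidiagonal 2).over E), ∀ x : (quasiSplit F E c 2).Adelic, f ((quasiSplit F E c 2).toAdelic b * x) = f x)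
    {𝓕 : Set ↥(adelicUnipotent F E c 2)} (h𝓕 : IsFundamentalDomain ↥(rationalUnipotent F E c 2) 𝓕 νN) (h𝓕₀ : νN 𝓕 ≠ 0) (h𝓕top : νN 𝓕 ≠ ⊤)
    (g : (quasiSplit F E c 2).Adelic)
    (hfin : ∫⁻ u in 𝓕, (∑' q : (quasiSplit F E c 2).quotientSubgroup ⧸ (borelAdelic F E c 2).subgroupOf (quasiSplit F E c 2).quotientSubgroup,
        ‖f ((((q.out : (quasiSplit F E c 2).quotientSubgroup) : (quasiSplit F E c 2).Adelic))⁻¹ * (u : (quasiSplit F E c 2).Adelic) * g)‖ₑ) ∂νN < ⊤)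
    (hs : Summable fun q : Quotient (orbitRel ↥(borelU (c : E →+* E) ((StdForm.antidiagonal 2).over E)) ↥(unitaryGroupOfForm (c : E →+* E) ((StdForm.antidiagonal 2).over E))) =>
      f ((quasiSplit F E c 2).toAdelic (Quotient.out q : ↥(unitaryGroupOfForm (c : E →+* E) ((StdForm.antidiagonal 2).over E))) * g))
    [MeasurableSpace (AdeleRing (𝓞 F) F)] [BorelSpace (AdeleRing (𝓞 F) F)] (μ : Measure (AdeleRing (𝓞 F) F)) [μ.IsAddHaarMeasure]
    {Φ : (AdeleRing (𝓞 F) F) → ℂ} (hΦ : ∀ t, Φ t = f (((quasiSplit F E c 2).toAdelic (weylLongU (c : E →+* E) (rfl : ((StdForm.antidiagonal 2).over E) = ((StdForm.antidiagonal 2).over E)))) * ((middleRootUnipotent hij hN (Multiplicative.ofAdd (traceZeroLine F E c hcδ hδ t)) : ↥(adelicUnipotent F E c 2)) : (quasiSplit F E c 2).Adelic) * g))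
    (hΦc : Continuous Φ) (hΦi : Integrable Φ μ)
    (hloc : ∀ C : Set (AdeleRing (𝓞 F) F), IsCompact C → ∃ u : F → ℝ, Summable u ∧
      ∀ x ∈ C, ∀ ξ : F, ‖Φ (x + algebraMap F (AdeleRing (𝓞 F) F) ξ)‖ ≤ u ξ)
    (hnorm : ((νN 𝓕).toReal⁻¹ : ℝ) • ∫ v : ↥(adelicUnipotent F E c 2), f (((quasiSplit F E c 2).toAdelic (weylLongU (c : E →+* E) (rfl : ((StdForm.antidiagonal 2).over E) = ((StdForm.antidiagonal 2).over E)))) * (v : (quasiSplit F E c 2).Adelic) * g) ∂νN =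
      ((μ (adeleFundamentalDomain F)).toReal⁻¹ : ℂ) * ∫ t, Φ t ∂μ)
    {Φk : (AdeleRing (𝓞 F) F) → ℂ} (m : ℂ) (lam : (AdeleRing (𝓞 F) F)ˣ) (y : (AdeleRing (𝓞 F) F)) (hdil : ∀ t, Φ t = m * Φk ((lam : (AdeleRing (𝓞 F) F)) * (t - y)))
    (hsumk : Summable fun ξ : F =>
      ‖∫ v, Φk v * (adeleAddChar F (algebraMap F (AdeleRing (𝓞 F) F) ξ * ((lam⁻¹ : (AdeleRing (𝓞 F) F)ˣ) : (AdeleRing (𝓞 F) F)) * v) : ℂ) ∂μ‖)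
    {C β σ : ℝ} (hC : 0 ≤ C)
    (hdec : ∑' ξ : F, ({0}ᶜ : Set F).indicator (fun ξ => ‖∫ v, Φk v * (adeleAddChar F (algebraMap F (AdeleRing (𝓞 F) F) ξ * ((lam⁻¹ : (AdeleRing (𝓞 F) F)ˣ) : (AdeleRing (𝓞 F) F)) * v) : ℂ) ∂μ‖) ξ ≤ C * ((((IdeleClassGroup.ideleNorm F lam : ℝ≥0) : ℝ))⁻¹) ^ (-β))
    (hm : ‖m‖ = (((IdeleClassGroup.ideleNorm F lam : ℝ≥0) : ℝ)) ^ σ) (hlam : (((IdeleClassGroup.ideleNorm F lam : ℝ≥0) : ℝ)) ≤ 1) (hσβ : 1 ≤ σ + β) :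
    ‖eisensteinSeriesU f g - borelConstantTerm νN 𝓕 (eisensteinSeriesU f) g‖ ≤ (μ (adeleFundamentalDomain F)).toReal⁻¹ * C := by
  have hpos : 0 < (((IdeleClassGroup.ideleNorm F lam : ℝ≥0) : ℝ)) := by
    have h0 : IdeleClassGroup.ideleNorm F lam ≠ 0 := ideleNorm_ne_zero (K := F) lam
    exact_mod_cast pos_iff_ne_zero.2 h0
  refine (norm_sub_borelConstantTerm_le_rpow_two hij hN hcδ hδ νN hfm hfN hfB h𝓕 h𝓕₀ h𝓕top g hfin hs μ hΦ hΦc hΦi hloc hnorm m lam y hdil hsumk hdec hm).trans ?_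
  have h1 : (((IdeleClassGroup.ideleNorm F lam : ℝ≥0) : ℝ)) ^ (σ + β - 1) ≤ 1 := Real.rpow_le_one hpos.le hlam (by linarith)
  calc (μ (adeleFundamentalDomain F)).toReal⁻¹ * C * (((IdeleClassGroup.ideleNorm F lam : ℝ≥0) : ℝ)) ^ (σ + β - 1)
      ≤ (μ (adeleFundamentalDomain F)).toReal⁻¹ * C * 1 :=
        mul_le_mul_of_nonneg_left h1 (mul_nonneg (inv_nonneg.2 ENNReal.toReal_nonneg) hC)
    _ = (μ (adeleFundamentalDomain F)).toReal⁻¹ * C := mul_one _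

end RankOne

end Summit.HodgeConjecture.HodgeConjecture.Cruxes.H413.K2E1EisensteinMinusConstantTermBoundU2

end
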